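import Summits.RiemannHypothesis.RiemannHypothesis.Theorems.SuzukiStructureFunctionsWindowFamily
import Literature.Analysis.OperatorTheory.IntegralOperatorHilbertSchmidt
import Literature.NumberTheory.LFunctions.SuzukiCanonicalSystem

/-!
# SuzukiStructureFunctionsWindowResolvent — the resolvents `(1 + ε𝖪[t])⁻¹` on `L²(ℝ)`: Suzuki's (K5) makes
# `1 + ε𝖪[t]` a unit, the inverse is continuous in `t`, and the window data move continuously in `L²(ℝ)`
# (JFA21 §3.3–§3.4; column DBR; RH-FREE)

LINE 1 — LABEL: RH-FREE (ζ-free operator theory for ANY continuous kernel on its clean windows; no zeros, no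
positivity); bears_on LADDER-RH B-D → B-P(P1)/(P2): second input of Thm. 3.1 (2) (continuity of `φ^ε(t,x)`, `μ(t)`,
`m(t)` in `t` — the declared residual `Suzuki2021_thm31_dynamics`). WHAT THIS IS NOT: not progress toward RH.

Source: M. Suzuki, J. Funct. Anal. 281 (2021) 109116 = arXiv:1606.05726 [Suzuki2021Hamiltonians], §3.1 (K5), Lemma 3.3
(Fredholm alternative), §3.4 (continuity in `t`); Reed–Simon I Thm. VI.23.

Contents (seat rh-dbr-eng-5 g7; continuation of `…WindowFamily`, p489828):
* `integral_winKer_mul_eq_setIntegral`, `integral_winKer_mul_eq_zero` — the `L²(ℝ)` kernel integral is the window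
  integral on `[−t,t]` and `0` outside;
* **`isUnit_one_add_smul_winOpL2`** — `NoUnitEigenvalue K t`, `ε = ±1` ⇒ `1 + ε𝖪[t]` is a unit on `L²(ℝ)` (compactness +
  Fredholm alternative; an eigenfunction would be a unit eigenfunction of the window operator);
* **`continuousWithinAt_inverse_winOpL2`** — at a clean `t₀`, `t ↦ (1 + ε𝖪[t])⁻¹` (`Ring.inverse`) is continuous within
  `[0,∞)` (inversion is continuous at units of a Banach algebra);
* `memLp_indicator_window`, **`continuousOn_toLp_indicator_window`** — for jointly continuous `G`,
  `t ↦ 𝟙_{[−t,t]}G(t,·) ∈ L²(ℝ)` is continuous on `[0,∞)` (dominated convergence; moving endpoints are null).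
-/

noncomputable section

-- D-0017: `Summit.<S>.<S>.…` is the designed namespace of a single-problem summit.
set_option linter.dupNamespace false

open MeasureTheory Set Filter Topology Function
open scoped ENNReal RealInnerProductSpace

namespace Summit.RiemannHypothesis.RiemannHypothesis.Theorems.SuzukiStructureFunctions

open Literature.Analysis.OperatorTheory Literature.NumberTheory.LFunctions

variable {K : ℝ → ℝ} {ε t : ℝ}

/-! ## §16 The resolvents `(1 + ε𝖪[t])⁻¹` on `L²(ℝ)`: invertibility on clean windows (Suzuki's (K5)) and
continuity in `t`; continuity of the window data `t ↦ 𝟙_{[−t,t]}G(t,·)` in `L²(ℝ)` -/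

/-- RH-FREE. For `x ∈ [−t,t]`, the `L²(ℝ)`-kernel integral is the window integral:
`∫ k_t(x,y)φ(y) dy = ∫_{(−t,t)} K(x+y)φ(y) dy`. -/
theorem integral_winKer_mul_eq_setIntegral (K : ℝ → ℝ) {t x : ℝ} (hx : x ∈ Icc (-t) t) (φ : ℝ → ℝ) :
    ∫ y, winKer K t x y * φ y = ∫ y in Ioo (-t) t, K (x + y) * φ y := by
  rw [← setIntegral_congr_set (Ioo_ae_eq_Icc (μ := (volume : Measure ℝ))).symm, ← integral_indicator measurableSet_Icc]
  refine integral_congr_ae (Eventually.of_forall fun y => ?_)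
  simp only [winKer]
  by_cases hy : y ∈ Icc (-t) t
  · rw [indicator_of_mem (mem_prod.2 ⟨hx, hy⟩), indicator_of_mem hy]
  · rw [indicator_of_notMem (fun h => hy (mem_prod.1 h).2), indicator_of_notMem hy, zero_mul]

/-- RH-FREE. For `x ∉ [−t,t]`, `∫ k_t(x,y)φ(y) dy = 0`. -/
theorem integral_winKer_mul_eq_zero (K : ℝ → ℝ) {t x : ℝ} (hx : x ∉ Icc (-t) t) (φ : ℝ → ℝ) :
    ∫ y, winKer K t x y * φ y = 0 := by
  refine integral_eq_zero_of_ae (Eventually.of_forall fun y => ?_)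
  simp only [winKer, Pi.zero_apply]
  rw [indicator_of_notMem (fun h => hx (mem_prod.1 h).1), zero_mul]

/-- **RH-FREE · SUZUKI'S (K5) ON `L²(ℝ)`: on a clean window (`NoUnitEigenvalue K t`), `1 + ε𝖪[t]` is a UNIT** of the
algebra of bounded operators on `L²(ℝ)` (`ε = ±1`): `𝖪[t]` is compact (Reed–Simon VI.23), so by the Fredholm
alternative either `−1` is an eigenvalue of `ε𝖪[t]` — whose eigenfunction, supported in `[−t,t]`, would be a unit
eigenfunction of the window operator, excluded by `NoUnitEigenvalue` — or it lies in the resolvent set. -/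
theorem isUnit_one_add_smul_winOpL2 (hK : Continuous K) (hε : ε = 1 ∨ ε = -1) (hN : NoUnitEigenvalue K t) :
    IsUnit (1 + ε • winOpL2 K hK t) := by
  set A := winOpL2 K hK t with hAdef
  have hA := winOpL2_spec hK t
  have hcpt : IsCompactOperator A := isCompactOperator_l2KernelOp (memLp_winKer hK t) hA
  have hcT : IsCompactOperator (ε • A) := hcpt.smul ε
  rcases hcT.hasEigenvalue_or_mem_resolventSet (μ := (-1 : ℝ)) (by norm_num) with h | h
  · exfalso
    obtain ⟨ψ, hψ⟩ := h.exists_hasEigenvector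
    have hψ0 : ψ ≠ 0 := hψ.2
    have heq : ε • A ψ = -ψ := by simpa using hψ.apply_eq_smul
    have hεsq : ε * ε = 1 := by rcases hε with rfl | rfl <;> norm_num
    have hAψ : A ψ = (-ε) • ψ := by
      have h1 : ε • (ε • A ψ) = ε • (-ψ) := by rw [heq]
      rw [smul_smul, hεsq, one_smul, smul_neg, ← neg_smul] at h1
      exact h1
    -- a.e. eigen-equation on `ℝ`
    have heig : ∀ᵐ x ∂(volume : Measure ℝ), ∫ y, winKer K t x y * ψ y = (-ε) * ψ x := by
      have h1 : (↑(A ψ) : ℝ → ℝ) =ᵐ[volume] fun x ↦ (-ε) * ψ x := by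
        rw [hAψ]
        filter_upwards [Lp.coeFn_smul (-ε) ψ] with x hx
        rw [hx, Pi.smul_apply, smul_eq_mul]
      filter_upwards [hA ψ, h1] with x e1 e2
      rw [← e1, e2]
    have hε' : (-ε) = 1 ∨ (-ε) = -1 := by rcases hε with rfl | rfl <;> norm_num
    have hεne : (-ε) ≠ 0 := by rcases hε with rfl | rfl <;> norm_num
    -- outside the window `ψ = 0` a.e.
    have hout : ∀ᵐ x ∂(volume : Measure ℝ), x ∉ Icc (-t) t → (ψ : ℝ → ℝ) x = 0 := by
      filter_upwards [heig] with x hx hxI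
      rw [integral_winKer_mul_eq_zero K hxI] at hx
      have : (-ε) * ψ x = 0 := hx.symm
      rcases mul_eq_zero.1 this with h | h
      · exact absurd h hεne
      · exact h
    -- inside: the restriction is a window eigenfunction, hence `0` a.e.
    have hin : (ψ : ℝ → ℝ) =ᵐ[volume.restrict (Ioo (-t) t)] 0 := by
      refine hN (-ε) hε' (ψ : ℝ → ℝ) ((Lp.memLp ψ).restrict _) ?_
      rw [ae_restrict_iff' measurableSet_Ioo]
      filter_upwards [heig] with x hx hxI
      rw [← hx, integral_winKer_mul_eq_setIntegral K (Ioo_subset_Icc_self hxI)]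
    have hin' : ∀ᵐ x ∂(volume : Measure ℝ), x ∈ Ioo (-t) t → (ψ : ℝ → ℝ) x = 0 :=
      (ae_restrict_iff' measurableSet_Ioo).1 hin
    -- the two endpoints are null
    have hpts : ∀ᵐ x ∂(volume : Measure ℝ), x ≠ -t ∧ x ≠ t := by
      have h1 : ({-t}ᶜ : Set ℝ) ∈ ae (volume : Measure ℝ) := compl_mem_ae_iff.mpr (measure_singleton _)
      have h2 : ({t}ᶜ : Set ℝ) ∈ ae (volume : Measure ℝ) := compl_mem_ae_iff.mpr (measure_singleton _)
      filter_upwards [h1, h2] with x hx1 hx2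
      exact ⟨hx1, hx2⟩
    have hzero : (ψ : ℝ → ℝ) =ᵐ[volume] (0 : ℝ → ℝ) := by
      filter_upwards [hout, hin', hpts] with x h1 h2 h3
      by_cases hx : x ∈ Ioo (-t) t
      · exact h2 hx
      · refine h1 fun hxI => hx ⟨lt_of_le_of_ne hxI.1 (Ne.symm h3.1), lt_of_le_of_ne hxI.2 h3.2⟩
    exact hψ0 (Lp.ext (hzero.trans (Lp.coeFn_zero _ _ _).symm))
  · rw [spectrum.mem_resolventSet_iff] at h
    have e : (algebraMap ℝ (Lp ℝ 2 (volume : Measure ℝ) →L[ℝ] Lp ℝ 2 (volume : Measure ℝ)) (-1) - ε • A) =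
        -(1 + ε • A) := by
      rw [map_neg, map_one]; abel
    rw [e, IsUnit.neg_iff] at h
    exact h

/-- RH-FREE. **Continuity of the resolvent in `t`:** at a clean window `t₀ ≥ 0`, `t ↦ (1 + ε𝖪[t])⁻¹` (Mathlib's
`Ring.inverse`, the honest inverse at units) is continuous within `[0,∞)` (inversion is continuous at units of a
Banach algebra; `t ↦ 𝖪[t]` is norm-continuous). -/
theorem continuousWithinAt_inverse_winOpL2 (hK : Continuous K) (hε : ε = 1 ∨ ε = -1) {t₀ : ℝ} (ht₀ : 0 ≤ t₀)
    (hN : NoUnitEigenvalue K t₀) :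
    ContinuousWithinAt (fun t : ℝ => Ring.inverse (1 + ε • winOpL2 K hK t)) (Ici 0) t₀ := by
  obtain ⟨u, hu⟩ := isUnit_one_add_smul_winOpL2 hK hε hN
  have h1 : ContinuousWithinAt (fun t : ℝ => (1 : Lp ℝ 2 (volume : Measure ℝ) →L[ℝ] Lp ℝ 2 (volume : Measure ℝ)) +
      ε • winOpL2 K hK t) (Ici 0) t₀ :=
    ((continuousOn_winOpL2 hK t₀ ht₀).const_smul ε).const_add _ |>.congr (fun _ _ => rfl) rfl
  have h2 : ContinuousAt Ring.inverse ((1 : Lp ℝ 2 (volume : Measure ℝ) →L[ℝ] Lp ℝ 2 (volume : Measure ℝ)) +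
      ε • winOpL2 K hK t₀) := by
    rw [← hu]; exact NormedRing.inverse_continuousAt u
  exact ContinuousAt.comp_continuousWithinAt (f := fun t : ℝ =>
    (1 : Lp ℝ 2 (volume : Measure ℝ) →L[ℝ] Lp ℝ 2 (volume : Measure ℝ)) + ε • winOpL2 K hK t) h2 h1

/-! ### The window data `t ↦ 𝟙_{[−t,t]}(·)G(t,·)` as a continuous `L²(ℝ)`-valued map -/

/-- RH-FREE. A jointly continuous `G` cut off to the window is square integrable. -/
theorem memLp_indicator_window {G : ℝ → ℝ → ℝ} (hG : Continuous (uncurry G)) (t : ℝ) :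
    MemLp (fun y : ℝ => (Icc (-t) t).indicator (fun y => G t y) y) 2 (volume : Measure ℝ) := by
  rw [memLp_indicator_iff_restrict measurableSet_Icc]
  haveI : IsFiniteMeasure ((volume : Measure ℝ).restrict (Icc (-t) t)) := by infer_instance
  have hc : Continuous fun y : ℝ => G t y := hG.comp (continuous_const.prodMk continuous_id)
  obtain ⟨C, hC⟩ := (isCompact_Icc (a := -t) (b := t)).exists_bound_of_continuousOn hc.continuousOn
  refine MemLp.of_bound hc.aestronglyMeasurable C ?_
  rw [ae_restrict_iff' measurableSet_Icc]
  exact Eventually.of_forall fun y hy => hC y hy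

/-- **RH-FREE · the window data move continuously in `L²(ℝ)`:** for a jointly continuous `G`,
`t ↦ 𝟙_{[−t,t]}(·)G(t,·) ∈ L²(ℝ)` is continuous on `[0,∞)` (dominated convergence; the moving endpoints `±t` are
null sets). Used for Suzuki's right-hand side `𝟙_{(−∞,t]}K(x+t)` (`G(t,y) = K(y+t)`) and for the rows
`y ↦ K(x+y)` (`G(t,y) = K(x+y)`), `y ↦ K(t+y)` (`G(t,y) = K(t+y)`). -/
theorem continuousOn_toLp_indicator_window {G : ℝ → ℝ → ℝ} (hG : Continuous (uncurry G)) :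
    ContinuousOn (fun t : ℝ => (memLp_indicator_window hG t).toLp _) (Ici 0) := by
  intro t₀ ht₀
  have ht₀' : 0 ≤ t₀ := ht₀
  -- work with the squared norm of the difference
  rw [ContinuousWithinAt, tendsto_iff_norm_sub_tendsto_zero]
  set F : ℝ → ℝ → ℝ := fun t y => (Icc (-t) t).indicator (fun y => G t y) y with hF
  have hFm : ∀ t, MemLp (F t) 2 (volume : Measure ℝ) := fun t => memLp_indicator_window hG t
  -- `‖toLp F t − toLp F t₀‖² = ∫ (F t − F t₀)²`
  have hnorm : ∀ t : ℝ, ‖(hFm t).toLp _ - (hFm t₀).toLp _‖ =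
      Real.sqrt (∫ y, (F t y - F t₀ y) ^ 2) := by
    intro t
    rw [← MemLp.toLp_sub (hFm t) (hFm t₀), ← Real.sqrt_sq (norm_nonneg _),
      norm_toLp_sq_eq_integral_norm_sq ((hFm t).sub (hFm t₀))]
    congr 1
    refine integral_congr_ae (Eventually.of_forall fun y => ?_)
    simp only [Pi.sub_apply, Real.norm_eq_abs, sq_abs]
  change Tendsto (fun t : ℝ => ‖(hFm t).toLp (F t) - (hFm t₀).toLp (F t₀)‖) (𝓝[Ici 0] t₀) (𝓝 0)
  simp_rw [hnorm]
  rw [← Real.sqrt_zero]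
  refine (Real.continuous_sqrt.tendsto 0).comp ?_
  -- dominated convergence on the `t`-range `[0, t₀ + 1]`
  set T : ℝ := t₀ + 1 with hT
  obtain ⟨M, hM⟩ := ((isCompact_Icc (a := (0:ℝ)) (b := T)).prod (isCompact_Icc (a := -T) (b := T))).exists_bound_of_continuousOn
    hG.continuousOn
  have hMnn : 0 ≤ M := (norm_nonneg _).trans (hM (0, 0) ⟨⟨le_rfl, by rw [hT]; linarith⟩, ⟨by rw [hT]; linarith, by rw [hT]; linarith⟩⟩)
  have hFle : ∀ t, t ∈ Icc 0 T → ∀ y, |F t y| ≤ M * (Icc (-T) T).indicator (fun _ => (1:ℝ)) y := by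
    intro t ht y
    simp only [hF]
    by_cases hy : y ∈ Icc (-t) t
    · have hyT : y ∈ Icc (-T) T := ⟨by linarith [hy.1, ht.2], by linarith [hy.2, ht.2]⟩
      rw [indicator_of_mem hy, indicator_of_mem hyT, mul_one]
      have := hM (t, y) ⟨ht, hyT⟩
      simpa [Real.norm_eq_abs] using this
    · rw [indicator_of_notMem hy, abs_zero]
      exact mul_nonneg hMnn (Set.indicator_nonneg (fun _ _ => zero_le_one) _)
  have hnhds : Icc 0 T ∈ 𝓝[Ici 0] t₀ := by
    rw [hT]
    exact mem_nhdsWithin.2 ⟨Iio (t₀ + 1), isOpen_Iio, by simp, fun t ht => ⟨ht.2, le_of_lt ht.1⟩⟩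
  have hGt : ∀ y : ℝ, Continuous fun t : ℝ => G t y := fun y => hG.comp (continuous_id.prodMk continuous_const)
  have hFmeas : ∀ t : ℝ, AEStronglyMeasurable (F t) (volume : Measure ℝ) := fun t => (hFm t).1
  suffices key : Tendsto (fun t : ℝ => ∫ y, (F t y - F t₀ y) ^ 2) (𝓝[Ici 0] t₀) (𝓝 (∫ _ : ℝ, (0 : ℝ))) by
    simpa using key
  refine tendsto_integral_filter_of_dominated_convergence
    (fun y => (2 * M) ^ 2 * (Icc (-T) T).indicator (fun _ => (1:ℝ)) y) ?_ ?_ ?_ ?_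
  · filter_upwards [hnhds] with t _
    exact (((hFmeas t).sub (hFmeas t₀)).norm.pow 2).congr (Eventually.of_forall fun y => by
      simp [Real.norm_eq_abs, sq_abs])
  · filter_upwards [hnhds] with t ht
    refine Eventually.of_forall fun y => ?_
    have h1 := hFle t ht y
    have h2 := hFle t₀ ⟨ht₀', by rw [hT]; linarith⟩ y
    rw [Real.norm_eq_abs, abs_pow]
    by_cases hy : y ∈ Icc (-T) T
    · rw [indicator_of_mem hy, mul_one] at h1 h2 ⊢
      have h3 : |F t y - F t₀ y| ≤ 2 * M := (abs_sub _ _).trans (by linarith)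
      exact pow_le_pow_left₀ (abs_nonneg _) h3 2
    · rw [indicator_of_notMem hy, mul_zero] at h1 h2 ⊢
      have e1 : F t y = 0 := abs_eq_zero.1 (le_antisymm h1 (abs_nonneg _))
      have e2 : F t₀ y = 0 := abs_eq_zero.1 (le_antisymm h2 (abs_nonneg _))
      rw [e1, e2]; simp
  · exact ((integrable_indicator_iff measurableSet_Icc).2 (integrableOn_const measure_Icc_lt_top.ne)).const_mul _
  · -- pointwise convergence off the two endpoints `±t₀`
    have hpts : ∀ᵐ y ∂(volume : Measure ℝ), y ≠ -t₀ ∧ y ≠ t₀ := by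
      have h1 : ({-t₀}ᶜ : Set ℝ) ∈ ae (volume : Measure ℝ) := compl_mem_ae_iff.mpr (measure_singleton _)
      have h2 : ({t₀}ᶜ : Set ℝ) ∈ ae (volume : Measure ℝ) := compl_mem_ae_iff.mpr (measure_singleton _)
      filter_upwards [h1, h2] with y hy1 hy2
      exact ⟨hy1, hy2⟩
    filter_upwards [hpts] with y hy
    have hlim : Tendsto (fun t : ℝ => F t y) (𝓝 t₀) (𝓝 (F t₀ y)) := by
      rcases lt_or_gt_of_ne (show |y| ≠ t₀ from fun h => by
        rcases abs_choice y with h' | h'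
        · exact hy.2 (by rw [← h, h'])
        · exact hy.1 (by rw [← h, h']; ring)) with hlt | hgt
      · -- `|y| < t₀`: eventually inside both windows
        have hev : ∀ᶠ t in 𝓝 t₀, F t y = G t y := by
          filter_upwards [Ioi_mem_nhds hlt] with t ht
          have hyt : y ∈ Icc (-t) t := abs_le.1 (le_of_lt ht)
          simp only [hF]; rw [indicator_of_mem hyt]
        have hy0 : y ∈ Icc (-t₀) t₀ := abs_le.1 hlt.le
        have e0 : F t₀ y = G t₀ y := by simp only [hF]; rw [indicator_of_mem hy0]
        rw [e0]
        exact ((hGt y).tendsto t₀).congr' (hev.mono fun t ht => ht.symm)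
      · -- `|y| > t₀`: eventually outside both windows
        have hev : ∀ᶠ t in 𝓝 t₀, F t y = 0 := by
          filter_upwards [Iio_mem_nhds hgt] with t ht
          have hyt : y ∉ Icc (-t) t := fun h => (abs_le.2 h).not_gt ht
          simp only [hF]; rw [indicator_of_notMem hyt]
        have hy0 : y ∉ Icc (-t₀) t₀ := fun h => (abs_le.2 h).not_gt hgt
        have e0 : F t₀ y = 0 := by simp only [hF]; rw [indicator_of_notMem hy0]
        rw [e0]
        exact tendsto_const_nhds.congr' (hev.mono fun t ht => ht.symm)
    have h2 : Tendsto (fun t : ℝ => (F t y - F t₀ y) ^ 2) (𝓝 t₀) (𝓝 ((F t₀ y - F t₀ y) ^ 2)) :=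
      (hlim.sub tendsto_const_nhds).pow 2
    rw [sub_self, zero_pow two_ne_zero] at h2
    exact h2.mono_left nhdsWithin_le_nhds

end Summit.RiemannHypothesis.RiemannHypothesis.Theorems.SuzukiStructureFunctions

end
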